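import Literature.Geometry.Lorentzian.KlainermanSzeftel2021.Dag
import Literature.Geometry.Lorentzian.GiorgiKlainermanSzeftel2022.InterpolatedRates

/-!
# Klainerman–Szeftel Thm 9.6.7 ⇐ Giorgi–Klainerman–Szeftel Thm 13.6.3 in the REFEREED pair: the integer ledger of the junction (J-range and decay-level dictionaries, both parities, with the priced interpolation repair)

CITATION HEADER (lean-in-tree rule 2026-08-18).  This module is a kernel-checked transcription of INTEGER AND SMALL-CONSTANT
BOOKKEEPING printed in two refereed papers, read in the following texts:

* [KS]  S. Klainerman, J. Szeftel, *Kerr stability for small angular momentum*, Pure Appl. Math. Q. **19** (2023) no. 3,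
  791–1678 = bib key `KlainermanSzeftel2023`, read as the authors' accepted version HAL hal-04280491 ("July 14, 2023",
  866 pp.; pages `HAL p.N` = PDF page of that file; its numbering is the arXiv-style `ch.sec.item`, and the journal's running
  numbers `9.n` are given next to it — the dictionary "journal 9.n = n-th numbered item of HAL chapter 9" is VALIDATED in the
  audit cell's file GAPS.md (block "JUNCTION IN THE REFEREED PAIR", adep1-g7) on all 19 numbered citations of [GKS] into [KS]);
  arXiv:2104.11857v1 (TeX `Main-Kerr-arxiv.tex`, lines `KS l.N`) = bib key `KlainermanSzeftel2021` where the v1 wording differs.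
* [GKS] E. Giorgi, S. Klainerman, J. Szeftel, *Wave equations estimates and the nonlinear stability of slowly rotating Kerr
  black holes*, Pure Appl. Math. Q. **20** (2024) no. 7, 2865–3849 = bib key `GiorgiKlainermanSzeftel2024`, read as the held
  text `paper:doi-10-4310-pamq-241128023033` (pages `PAMQ p.N` = PDF page); arXiv:2205.14808v1 (TeX `FinalKerrarxivversion.tex`,
  lines `GKS l.N`) = bib key `GiorgiKlainermanSzeftel2022`.

WHAT IS TRANSCRIBED (every `def` below is a printed integer, range or exponent; nothing else):
1. `k_small = ⌊k_large/2⌋ + 1` — [KS] (3.4.6) (HAL p.140 L32–38; v1 KS l.6113) = `Dag.kSmall` (imported, not redeclared).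
2. `k_L = k_large + 7` — [GKS] §1.5.3 "we choose k_L = k_large + 7" (PAMQ p.45 L18; v1 GKS l.1795) and Thm 1.5.4 "for k_L = k_large
   + 7" (PAMQ p.46 L51; v1 GKS l.1860); Part III uses `k_L` without restating the value → `kL`.
3. The J-RANGES printed for one and the same theorem ("Control of Curvature"):
   * [KS] Thm 9.4.15 (journal Thm 9.49; HAL p.627 L13): "Let J such that k_small − 1 ≤ J ≤ k_large + 6"; its proof (HAL p.652
     L63 – p.653): "According to Theorem 9.6.7, we have, for J such that J ≤ k_large + 6, …"; the iteration assumption (9.4.35)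
     (journal (9.52)) is made "for J in the range k_small − 1 ≤ J ≤ k_large + 5" (HAL p.626 L41) and holds at J = k_small − 1 by
     Remark 9.4.14 (HAL p.627 L7–9) → `ksRange` = `[k_small − 1, k_large + 6]`;
   * [KS] Thm 9.6.7 (journal Thm 9.65; HAL p.653 L2): "Let J such that J ≤ k_large + 6", Remark 9.6.8 (journal 9.66): "Theorem
     9.6.7 is proved in a separate paper, see Theorem 13.6.3 in [28]" → `ks967Range` = `[0, k_large + 6]`;
   * [GKS] Thm 13.6.3 (PAMQ p.627 L64; v1 GKS l.25956): "Let J be such that k_L/2 ≤ J ≤ k_L − 1" → `gksRange`;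
     [GKS] Thm 1.5.4 "(Theorem 9.65 of [56])" (PAMQ p.47 L1): "Let k_small − 1 ≤ J ≤ k_large + 6" (= `ksRange`);
     [GKS] fn 65 (PAMQ p.59): "To initiate the iteration procedure, we start at J = k_L/2 for which we have full control of G_J
     and R_J …, see Lemma 9.47 in [56]" — journal Lemma 9.47 = HAL Lemma 9.4.13, whose (9.4.23) is `G_{k_small−1} + R_{k_small−1} ≲ ε₀`.
4. The DECAY LEVELS: demanded by [GKS] (13.6.3) (PAMQ p.627 L15–22; v1 GKS l.25900–25905): "… ≤ ε τ_trap^{−(1+δ_dec)}, k ≤ k_L/2,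
   see (9.43) in [56]" with fn 8 "(13.6.3) is in fact weaker than the corresponding control in (9.43) of [56]" → `decayDemandLevel`
   = `⌊k_L/2⌋`; supplied by [KS] Lemma 9.4.13 (journal 9.47) display (9.4.24) (HAL p.624) and Remark 9.6.6 (journal 9.64) display
   (9.6.5) (HAL p.652): "for k ≤ k_small − 1, sup_{(int)M′(u ≤ u_* − 1)} u^{1+3δ_dec/4}{|𝔡^{≤k}Γ̌| + |𝔡^{≤k}Ř|} ≲ ε₀ … is used in the
   wave estimates of [28] to control nonlinear terms in the trapped region" → `decaySupplyLevel` = `k_small − 1`.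
5. The LOW-FACTOR LEVEL of a nonlinear term with `n` derivatives, `⌊n/2⌋` — the reading under which [GKS] states (13.6.3) at
   `k ≤ k_L/2` for products `𝔡^{≤J+1}(Γ·Γ)`, `J + 1 ≤ k_L`, and uses it in the proof of Thm 14.1.6 (PAMQ p.633 L50–62; v1 GKS
   l.26215–26222: "(𝔖_s + ℜ_s)∫‖𝔡^{≤s/2}(Γ̌, Ř)‖_{L²(Σ_trap(τ))} … ≲ ε²∫dτ/τ^{1+δ_dec}", `s ≤ k_L − 3`) → `lowFactorLevel`.  THIS IS THE
   MODULE'S READING of where the hypothesis level `k_L/2` comes from (standard product-estimate bookkeeping), flagged as such.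
6. The RATES: v1 KS Lemma 9.4.13 interior PT-frame weight `ū^{1/2+δ_dec}` (KS l.24416–24418), refereed [KS] (9.4.24)/(9.6.5) weight
   `u^{1+3δ_dec/4}`, [GKS] (13.6.3) weight `τ_trap^{1+δ_dec}` → `rateV1`, `rateJ`, `rateGKS`; and the interpolation exponent of
   [KS] Lemma 5.1 (v1 KS l.9622–9672) / refereed [KS] §4.2 display (4.2.6) (HAL p.191; = journal (4.6) BY CONTENT — the
   display [GKS] PAMQ p.477 cites as "(4.6) in [56] … for the interpolation argument"; equation numerals of the journal are NOT
   rank-reconstructible from the HAL text, GAPS.md (N) / REFEREE #32 P6a, v3) = `InterpolatedRates.interpExponent` (imported).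

WHAT IS CERTIFIED.  Pure `ℕ`/`ℝ` arithmetic on these printed data (0 sorry; axioms ⊆ {propext, Classical.choice, Quot.sound}).
NOTHING about the Einstein equations, the norms, or the truth of any estimate of either paper is asserted; the papers are
UNDER ADJUDICATION by the audit cell only in the sense that their cross-citations are compared word by word.
* §2 (J-range ledger): `gksRange = [⌊k_large/2⌋ + 4, k_large + 6] ⊆ ksRange ⊆ ks967Range`; the iteration steps of [KS] §9.4.8
  NOT covered by the range of [GKS] Thm 13.6.3 are EXACTLY `J ∈ [⌊k_large/2⌋, ⌊k_large/2⌋ + 3]` — four steps, for every `k_large`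
  and both parities (`uncovered_eq`, `uncovered_card`); they are the BOTTOM of the iteration, where the low factor of a product at
  level `J + 1` needs at most `⌊k_large/4⌋ + 2 ≤ k_small − 1` derivatives once `k_large ≥ 8` (`uncovered_lowFactor_supplied`) — the
  kernel form of the audit cell's reading (GAPS.md E3 (3)) that the lower bound `k_L/2` is a STATEMENT-LEVEL mismatch only.
* §3 (decay-level ledger): `decayDemandLevel − decaySupplyLevel = 3 + k_large % 2` (`demand_sub_supply`: 3 levels for even
  `k_large`, 4 for odd — the integers of GAPS.md C-1/E15, unchanged in the refereed pair); the steps `J ∈ ksRange` at which the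
  low-factor level `⌊(J+1)/2⌋` EXCEEDS the supplied `k_small − 1` are exactly `J ∈ [2⌊k_large/2⌋ + 1, k_large + 6]`
  (`biting_eq`, `biting_card` = `6 + k_large % 2`), all of them INSIDE `gksRange` once `k_large ≥ 6` (`biting_subset_gksRange`): the
  decay-hypothesis deficit bites at the TOP 6–7 steps, where [GKS]'s theorem IS stated, i.e. it is a hypothesis-supply gap between
  the two refereed texts, not a range gap; at the printed use in the proof of Thm 14.1.6 (`s ≤ k_L − 3`) the excess is 2 levels
  (`use1416_excess`).
* §4 (rate ledger): the v1 interior supply exponent `1/2 + δ` is `≤ 1` (not time-integrable) iff `δ ≤ 1/2` (`rateV1_le_one_iff`);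
  the refereed supply `1 + 3δ/4` is `> 1` and `< 1 + δ` for `δ > 0` (`rateJ_gt_one`, `rateJ_lt_rateGKS`): the refereed [KS] made the
  hand-off integrable (and says so, Remark 9.6.6 + footnote 21, HAL p.652) while the two printed exponents stay unequal; [GKS]
  Remark 13.6.6 (PAMQ p.628) and the proof of Thm 14.1.6 (p.633) exploit ONLY `∫₁^∞ dτ/τ^{rate} < ∞`.
* §5 (priced repair, the papers' own device — [KS] Lemma 5.1/(4.2.6), [GKS] Remark 11.1.1 — NOT invoked by either text for Part
  III): interpolating a sup bound with decay exponent `ρ > 1` at level `a` against a sup bound WITHOUT decay at level `a + S`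
  gives at level `a + j` the exponent `ρ(1 − j/S)` (`interpExponent`), which is `> 1 ⟺ j·ρ < (ρ − 1)·S` (`interp_gt_one_iff`);
  with `ρ = 1 + 3δ/4`: `⟺ j(4 + 3δ) < 3δ S` (`repair_iff`).  Reading the no-decay level as `k_large + 5` (= BA-PT's `k_large + 7`,
  [KS] (9.4.34) = journal (9.42), minus 2 for a sphere Sobolev embedding — the MODULE'S READING, a parameter `S` in the lemmas)
  and `a = k_small − 1 = m` for `k_large = 2m` resp. `2m + 1`: the missing `j = 3` resp. `4` levels get an integrable rate
  `⟺ 4 − 2δ < δ·m` resp. `16 − 6δ < 3δ·m` (`repair_even_iff`, `repair_odd_iff`), i.e. `k_large > 8/δ_dec − 4` resp.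
  `k_large > 32/(3δ_dec) − 3` — inside [KS] (3.4.1) "k_large ≫ 1/δ_dec" (HAL p.140) with an explicit constant ≈ 11, the same schema
  and order of magnitude as the cell's finding E1 (`InterpolatedRates`: 1040, 480(1+δ)/δ).  This prices the gap; it does not
  close it (the interpolation itself, the Sobolev step and the frame dictionary τ ↔ u are analysis, not transcribed here).

STATUS OF THE SOURCES.  Both papers are refereed; this file neither re-proves nor disputes any analytic estimate.  It is the
kernel companion of the audit cell's standing finding "G-1 (J-range half) / C-1 / E15" AS IT READS IN THE REFEREED PAIR: the
cited theorem ([GKS] 13.6.3) carries the hypotheses `J ≥ k_L/2` and "(13.6.3) at k ≤ k_L/2", the citing theorem ([KS] 9.6.7) is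
stated for all `J ≤ k_large + 6` and the citing paper supplies decay at `k ≤ k_small − 1`; [GKS] fn 8's "(13.6.3) is in fact
weaker than … (9.43) of [56]" does not hold coordinate-wise as printed (level `k_L/2 > k_small − 1`, exponent `δ_dec > 3δ_dec/4`),
holds for the constant (`ε` vs `ε₀`), and the mechanism printed in [GKS] needs only integrability and the low-factor split.
A journal referee would most likely have the authors add one interpolation remark to §13.6.1; until then the junction is a
MISMATCH OF PRINTED INTEGERS, priced here.  Nothing in this file is Final-State-Conjecture progress.

RELATION TO EXISTING TREE MATERIAL.  `Dag.kSmall`, `Ch9Iteration.kS/kL` (same integers over the abstract carrier);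
`IterationStep.iter_step_of_GKS_13_6_8` is stated for `J` in BOTH ranges and its docstring records that "it says nothing for
k_small − 1 ≤ J < k_L/2" — §2 below is the exact extent of that clause; `IterationClosure` runs the J-induction over `ksRange`
from hypotheses at every step; `GiorgiKlainermanSzeftel2022.CurvatureAssembly` (K18) assembles 13.6.3 from its leaves with
(13.6.3) as a named hypothesis; `InterpolatedRates` supplies `interpExponent` and the E1 thresholds that §5 parallels.
Mathlib + those two imports only.

## Contents
* §1 the printed integers and rates; §2 J-range ledger; §3 decay-level ledger; §4 rate ledger; §5 priced interpolation repair.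

Versions: v1 = gate p180228 (2026-08-18); v2 = docstring-only locator fix ((3.4.6) is on HAL p.140, not p.141); no declaration changed.
-/

noncomputable section

namespace Literature.Geometry.Lorentzian.KlainermanSzeftel2021.JunctionLevels

open Finset
open Literature.Geometry.Lorentzian.GiorgiKlainermanSzeftel2022.InterpolatedRates (interpExponent)

/-! ## §1 The printed integers, ranges and rates -/

/-- [GKS] "we choose `k_L = k_large + 7`" for the curvature estimates of Theorem M8 (PAMQ p.45 L18, Thm 1.5.4 p.46 L51; v1 GKS
l.1795, l.1860); same integer as `Ch9Iteration.kL`. [cite: GiorgiKlainermanSzeftel2024, §1.5.3 and Thm 1.5.4, PAMQ PDF p.45–46] -/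
def kL (kLarge : ℕ) : ℕ := kLarge + 7

/-- [KS] Thm 9.4.15 (journal Thm 9.49, HAL p.627 L13) and §9.4.8: the iteration runs over `k_small − 1 ≤ J ≤ k_large + 6`
(iteration assumption (9.4.35) = journal (9.52) for `k_small − 1 ≤ J ≤ k_large + 5`, start at `J = k_small − 1` by Remark 9.4.14).
[cite: KlainermanSzeftel2023, Thm 9.4.15 / Remark 9.4.14 / (9.4.35), HAL hal-04280491 p.626–627] -/
def ksRange (kLarge : ℕ) : Finset ℕ := Icc (kSmall kLarge - 1) (kLarge + 6)

/-- [KS] Thm 9.6.7 (journal Thm 9.65, HAL p.653 L2): "Let J such that `J ≤ k_large + 6`" — no lower bound printed; used in the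
proof of Thm 9.4.15 "for J such that J ≤ k_large + 6" (HAL p.652 L63). [cite: KlainermanSzeftel2023, Thm 9.6.7, HAL hal-04280491 p.653] -/
def ks967Range (kLarge : ℕ) : Finset ℕ := Icc 0 (kLarge + 6)

/-- [GKS] Thm 13.6.3 (PAMQ p.627 L64; v1 GKS l.25956): "Let J be such that `k_L/2 ≤ J ≤ k_L − 1`"; for an integer `J`,
`k_L/2 ≤ J ⟺ k_L ≤ 2J`, and `k_L − 1 = k_large + 6`. [cite: GiorgiKlainermanSzeftel2024, Thm 13.6.3, PAMQ PDF p.627] -/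
def gksRange (kLarge : ℕ) : Finset ℕ := (Icc 0 (kLarge + 6)).filter (fun J => kL kLarge ≤ 2 * J)

/-- [GKS] (13.6.3): decay hypothesis for `k ≤ k_L/2` (PAMQ p.627 L15–22, "see (9.43) in [56]"); for integer `k` this is
`k ≤ ⌊k_L/2⌋`. [cite: GiorgiKlainermanSzeftel2024, (13.6.3), PAMQ PDF p.627] -/
def decayDemandLevel (kLarge : ℕ) : ℕ := kL kLarge / 2

/-- [KS] Lemma 9.4.13 (journal 9.47) display (9.4.24) (HAL p.624) and Remark 9.6.6 (journal 9.64) display (9.6.5) (HAL p.652):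
decay supplied "for `k ≤ k_small − 1`". [cite: KlainermanSzeftel2023, Lemma 9.4.13 (9.4.24) and Remark 9.6.6 (9.6.5), HAL hal-04280491 p.624/p.652] -/
def decaySupplyLevel (kLarge : ℕ) : ℕ := kSmall kLarge - 1

/-- The number of derivatives carried by the LOW factor of a quadratic term with `n` derivatives in total, `⌊n/2⌋` — the
reading under which [GKS] states (13.6.3)/(13.6.4) at `k ≤ k_L/2` and writes `𝔡^{≤s/2}` in the proof of Thm 14.1.6 (PAMQ p.633;
v1 GKS l.26218).  MODULE'S READING (standard product bookkeeping), not a printed definition.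
[cite: GiorgiKlainermanSzeftel2024, proof of Thm 14.1.6, PAMQ PDF p.633 L50–62] -/
def lowFactorLevel (n : ℕ) : ℕ := n / 2

/-- v1 KS Lemma 9.4.13, interior PT-frame decay weight `ū^{1/2+δ_dec}` (KS l.24416–24418): exponent `1/2 + δ`.
[cite: KlainermanSzeftel2021, proof of Lemma 9.4.13, TeX l.24416–24418] -/
def rateV1 (δ : ℝ) : ℝ := 1 / 2 + δ

/-- Refereed [KS] (9.4.24) = (9.4.32) and (9.6.5): interior weight `u^{1 + 3δ_dec/4}` (HAL p.624, p.626, p.652): exponent `1 + 3δ/4`.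
[cite: KlainermanSzeftel2023, (9.4.24)/(9.6.5), HAL hal-04280491 p.624/p.652] -/
def rateJ (δ : ℝ) : ℝ := 1 + 3 * δ / 4

/-- [GKS] (13.6.3): weight `τ_trap^{1+δ_dec}` (PAMQ p.627; v1 GKS l.25903): exponent `1 + δ`.
[cite: GiorgiKlainermanSzeftel2024, (13.6.3), PAMQ PDF p.627] -/
def rateGKS (δ : ℝ) : ℝ := 1 + δ

/-- Unfolding lemma for `Dag.kSmall`. [folklore] -/
@[simp] lemma kSmall_def (kLarge : ℕ) : kSmall kLarge = kLarge / 2 + 1 := rfl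
/-- Unfolding lemma for `kL`. [folklore] -/
@[simp] lemma kL_def (kLarge : ℕ) : kL kLarge = kLarge + 7 := rfl

/-! ## §2 The J-range ledger -/

/-- [GKS]'s range is the integer interval `[⌊k_large/2⌋ + 4, k_large + 6]` (both parities: `⌈(k_large+7)/2⌉ = ⌊k_large/2⌋ + 4`).
[cite: GiorgiKlainermanSzeftel2022, Thm 13.6.3 (journal = v1 numbering), PAMQ PDF p.627 L64, TeX l.25956] -/
theorem gksRange_eq_Icc (kLarge : ℕ) : gksRange kLarge = Icc (kLarge / 2 + 4) (kLarge + 6) := by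
  ext J
  simp only [gksRange, kL, mem_filter, mem_Icc]
  omega

/-- [KS]'s range is `[⌊k_large/2⌋, k_large + 6]` (`k_small − 1 = ⌊k_large/2⌋`). [cite: KlainermanSzeftel2021, refereed Thm 9.4.15 (journal 9.49) / (9.4.35) / Remark 9.4.14, HAL hal-04280491 p.626–627] -/
theorem ksRange_eq_Icc (kLarge : ℕ) : ksRange kLarge = Icc (kLarge / 2) (kLarge + 6) := by
  simp [ksRange]

/-- The range of the cited theorem lies inside the range over which the citing paper uses it …
[cite: GiorgiKlainermanSzeftel2022, Thm 13.6.3 (journal = v1 numbering), PAMQ PDF p.627 L64, TeX l.25956; KlainermanSzeftel2021, refereed Thm 9.4.15 (journal 9.49) / (9.4.35) / Remark 9.4.14, HAL hal-04280491 p.626–627] -/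
theorem gksRange_subset_ksRange (kLarge : ℕ) : gksRange kLarge ⊆ ksRange kLarge := by
  intro J hJ
  rw [gksRange_eq_Icc, mem_Icc] at hJ
  rw [ksRange_eq_Icc, mem_Icc]
  omega

/-- … which lies inside the range printed in [KS] Thm 9.6.7 ("J ≤ k_large + 6", no lower bound).
[cite: KlainermanSzeftel2021, refereed Thm 9.6.7 (journal 9.65), HAL hal-04280491 p.653 L2] -/
theorem ksRange_subset_ks967Range (kLarge : ℕ) : ksRange kLarge ⊆ ks967Range kLarge := by
  intro J hJ
  rw [ksRange_eq_Icc, mem_Icc] at hJ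
  simp only [ks967Range, mem_Icc]
  omega

/-- **G-1, J-range half, in the refereed pair.** The iteration steps of [KS] §9.4.8 at which [KS] Thm 9.4.15 ⇐ Thm 9.6.7 ⇐
"[GKS] Thm 13.6.3" is invoked OUTSIDE the J-range printed in [GKS] Thm 13.6.3 are exactly `J ∈ [⌊k_large/2⌋, ⌊k_large/2⌋ + 3]`.
[cite: KlainermanSzeftel2021, refereed Thm 9.4.15 (journal 9.49) / (9.4.35) / Remark 9.4.14, HAL hal-04280491 p.626–627; GiorgiKlainermanSzeftel2022, Thm 13.6.3 (journal = v1 numbering), PAMQ PDF p.627 L64, TeX l.25956] -/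
theorem uncovered_eq (kLarge : ℕ) :
    ksRange kLarge \ gksRange kLarge = Icc (kLarge / 2) (kLarge / 2 + 3) := by
  ext J
  simp only [mem_sdiff, ksRange_eq_Icc, gksRange_eq_Icc, mem_Icc]
  omega

/-- Four uncovered steps, for every `k_large` (both parities). [cite: KlainermanSzeftel2021, refereed Thm 9.4.15 (journal 9.49) / (9.4.35) / Remark 9.4.14, HAL hal-04280491 p.626–627; GiorgiKlainermanSzeftel2022, Thm 13.6.3 (journal = v1 numbering), PAMQ PDF p.627 L64, TeX l.25956] -/
theorem uncovered_card (kLarge : ℕ) : (ksRange kLarge \ gksRange kLarge).card = 4 := by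
  rw [uncovered_eq, Nat.card_Icc]
  omega

/-- The uncovered steps are the BOTTOM of the iteration: there the low factor of a product at level `J + 1` carries at most
`⌊(⌊k_large/2⌋ + 4)/2⌋ ≤ k_small − 1` derivatives as soon as `k_large ≥ 8` — decay IS supplied at those steps (cf. GAPS.md E3 (3):
[GKS]'s proof uses its lower bound only through "J ≥ 5"-type conditions).  The product-split reading is the module's. [folklore] -/
theorem uncovered_lowFactor_supplied {kLarge J : ℕ} (hk : 8 ≤ kLarge) (hJ : J ∈ ksRange kLarge \ gksRange kLarge) :
    lowFactorLevel (J + 1) ≤ decaySupplyLevel kLarge := by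
  rw [uncovered_eq, mem_Icc] at hJ
  simp only [lowFactorLevel, decaySupplyLevel, kSmall]
  omega

/-- For the record: [GKS]'s lower bound exceeds [KS]'s starting level by `4` exactly (`⌈k_L/2⌉ − (k_small − 1) = 4`), while as a
real number `k_L/2 − (k_small − 1) = 7/2` (even `k_large`) resp. `4` (odd). [cite: GiorgiKlainermanSzeftel2022, Thm 13.6.3 (journal = v1 numbering), PAMQ PDF p.627 L64, TeX l.25956; KlainermanSzeftel2021, refereed Thm 9.4.15 (journal 9.49) / (9.4.35) / Remark 9.4.14, HAL hal-04280491 p.626–627] -/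
theorem gks_lower_sub_ks_lower (kLarge : ℕ) : (kLarge / 2 + 4) - (kSmall kLarge - 1) = 4 := by
  simp only [kSmall]; omega

/-! ## §3 The decay-level ledger -/

/-- **C-1 / E15 in the refereed pair.** Demanded level minus supplied level = `3` (even `k_large`) / `4` (odd).
[cite: GiorgiKlainermanSzeftel2022, (13.6.3) "k ≤ k_L/2", PAMQ PDF p.627, TeX l.25900–25905; KlainermanSzeftel2021, refereed (9.4.24)/(9.6.5) "k ≤ k_small − 1", HAL hal-04280491 p.624/p.652] -/
theorem demand_sub_supply (kLarge : ℕ) :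
    decayDemandLevel kLarge - decaySupplyLevel kLarge = 3 + kLarge % 2 := by
  simp only [decayDemandLevel, decaySupplyLevel, kL, kSmall]
  omega

/-- The supplied level never reaches the demanded one. [cite: GiorgiKlainermanSzeftel2022, (13.6.3), PAMQ PDF p.627; KlainermanSzeftel2021, refereed (9.6.5), HAL hal-04280491 p.652] -/
theorem supply_lt_demand (kLarge : ℕ) : decaySupplyLevel kLarge < decayDemandLevel kLarge := by
  simp only [decayDemandLevel, decaySupplyLevel, kL, kSmall]
  omega

/-- [GKS]'s demanded level is exactly what the low factor of a top-order (`k_L` derivatives) product needs (module's reading). [folklore] -/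
theorem demand_eq_lowFactor_top (kLarge : ℕ) : decayDemandLevel kLarge = lowFactorLevel (kL kLarge) := rfl

/-- At iteration step `J` (estimating level `J + 1`) the low-factor level is within [KS]'s supply iff `J ≤ 2⌊k_large/2⌋`
(`= k_large` for even, `k_large − 1` for odd `k_large`). [folklore] -/
theorem lowFactor_supplied_iff (kLarge J : ℕ) :
    lowFactorLevel (J + 1) ≤ decaySupplyLevel kLarge ↔ J ≤ 2 * (kLarge / 2) := by
  simp only [lowFactorLevel, decaySupplyLevel, kSmall]
  omega

/-- The steps of [KS]'s iteration at which the low-factor level EXCEEDS the supplied decay level are exactly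
`J ∈ [2⌊k_large/2⌋ + 1, k_large + 6]`. [cite: KlainermanSzeftel2021, refereed Thm 9.4.15 (journal 9.49) / (9.4.35) / Remark 9.4.14, HAL hal-04280491 p.626–627; KlainermanSzeftel2021, refereed (9.6.5), HAL hal-04280491 p.652] -/
theorem biting_eq (kLarge : ℕ) :
    (ksRange kLarge).filter (fun J => decaySupplyLevel kLarge < lowFactorLevel (J + 1))
      = Icc (2 * (kLarge / 2) + 1) (kLarge + 6) := by
  ext J
  simp only [mem_filter, ksRange_eq_Icc, mem_Icc, lowFactorLevel, decaySupplyLevel, kSmall]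
  omega

/-- Their number: `6` (even `k_large`) / `7` (odd). [cite: KlainermanSzeftel2021, refereed Thm 9.4.15 (journal 9.49) / (9.4.35) / Remark 9.4.14, HAL hal-04280491 p.626–627] -/
theorem biting_card (kLarge : ℕ) :
    ((ksRange kLarge).filter (fun J => decaySupplyLevel kLarge < lowFactorLevel (J + 1))).card = 6 + kLarge % 2 := by
  rw [biting_eq, Nat.card_Icc]
  omega

/-- They all lie INSIDE the range printed in [GKS] Thm 13.6.3 once `k_large ≥ 6`: the decay deficit is a hypothesis-supply gap
at steps where the cited theorem is stated, not a range gap. [cite: GiorgiKlainermanSzeftel2022, Thm 13.6.3 (journal = v1 numbering), PAMQ PDF p.627 L64, TeX l.25956; KlainermanSzeftel2021, refereed Thm 9.4.15 (journal 9.49) / (9.4.35) / Remark 9.4.14, HAL hal-04280491 p.626–627] -/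
theorem biting_subset_gksRange {kLarge : ℕ} (hk : 6 ≤ kLarge) :
    (ksRange kLarge).filter (fun J => decaySupplyLevel kLarge < lowFactorLevel (J + 1)) ⊆ gksRange kLarge := by
  intro J hJ
  rw [biting_eq, mem_Icc] at hJ
  rw [gksRange_eq_Icc, mem_Icc]
  omega

/-- The levels at which decay is demanded but not supplied: `(k_small − 1, ⌊k_L/2⌋]`, i.e. `[⌊k_large/2⌋ + 1, ⌊k_large/2⌋ + 3 + k_large % 2]`.
[cite: GiorgiKlainermanSzeftel2022, (13.6.3), PAMQ PDF p.627; KlainermanSzeftel2021, refereed (9.4.24)/(9.6.5), HAL hal-04280491 p.624/p.652] -/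
theorem missing_levels_eq (kLarge : ℕ) :
    Ioc (decaySupplyLevel kLarge) (decayDemandLevel kLarge) = Icc (kLarge / 2 + 1) (kLarge / 2 + 3 + kLarge % 2) := by
  ext k
  simp only [mem_Ioc, mem_Icc, decaySupplyLevel, decayDemandLevel, kL, kSmall]
  omega

/-- At the printed use ([GKS] proof of Thm 14.1.6, `𝔡^{≤s/2}` with `s ≤ k_L − 3`, PAMQ p.633) the low-factor level exceeds the
supply by exactly `2` at the top `s`. [cite: GiorgiKlainermanSzeftel2022, proof of Thm 14.1.6 (v1 Thm:Estimates-forqf), PAMQ PDF p.633 L50–62, TeX l.26215–26222] -/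
theorem use1416_excess (kLarge : ℕ) : lowFactorLevel (kL kLarge - 3) - decaySupplyLevel kLarge = 2 := by
  simp only [lowFactorLevel, decaySupplyLevel, kL, kSmall]
  omega

/-! ## §4 The rate ledger -/

/-- v1: the interior supply exponent `1/2 + δ` is not integrable in time (`≤ 1`) iff `δ ≤ 1/2` — in particular for
[KS]'s `δ_dec ≪ 1`. [cite: KlainermanSzeftel2021, proof of Lemma 9.4.13 (v1), TeX l.24416–24418] -/
theorem rateV1_le_one_iff (δ : ℝ) : rateV1 δ ≤ 1 ↔ δ ≤ 1 / 2 := by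
  simp only [rateV1]; constructor <;> intro h <;> linarith

/-- Refereed [KS]: the supply exponent `1 + 3δ/4` IS integrable for `δ > 0` … [cite: KlainermanSzeftel2021, refereed (9.4.24)/(9.6.5) and Remark 9.6.6 footnote 21, HAL hal-04280491 p.624/p.652] -/
theorem rateJ_gt_one {δ : ℝ} (hδ : 0 < δ) : 1 < rateJ δ := by
  simp only [rateJ]; linarith

/-- … and is strictly below [GKS]'s printed demand `1 + δ` for `δ > 0` (so (13.6.3) is NOT "weaker than" the supply in this
coordinate, contrary to [GKS] fn 8 as printed) … [cite: GiorgiKlainermanSzeftel2022, (13.6.3) and footnote 8, PAMQ PDF p.627 L15–22/L69] -/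
theorem rateJ_lt_rateGKS {δ : ℝ} (hδ : 0 < δ) : rateJ δ < rateGKS δ := by
  simp only [rateJ, rateGKS]; linarith

/-- … by exactly `δ/4`. [folklore] -/
theorem rateGKS_sub_rateJ (δ : ℝ) : rateGKS δ - rateJ δ = δ / 4 := by
  simp only [rateJ, rateGKS]; ring

/-- The refereed revision raised the interior supply exponent by `1/2 − δ/4` (from v1's `1/2 + δ` to `1 + 3δ/4`).
[cite: KlainermanSzeftel2021, Lemma 9.4.13 v1 TeX l.24416–24418 vs refereed (9.4.24) HAL hal-04280491 p.624] -/
theorem rateJ_sub_rateV1 (δ : ℝ) : rateJ δ - rateV1 δ = 1 / 2 - δ / 4 := by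
  simp only [rateJ, rateV1]; ring

/-! ## §5 The priced repair: interpolating decay at level `a` against boundedness at level `a + S` -/

/-- `InterpolatedRates.interpExponent` evaluated on a span: with decay exponent `ρ` at level `a`, none at level `a + S`, the
level `a + j` gets `ρ (1 − j/S)`. [cite: KlainermanSzeftel2021, Lemma 5.1 proof, TeX l.9634–9640 (exponent shape); arithmetic folklore] -/
theorem interpExponent_span (ρ a S j : ℝ) :
    interpExponent ρ a (a + S) (a + j) = ρ * (1 - j / S) := by
  simp only [interpExponent]
  rw [show a + j - a = j by ring, show a + S - a = S by ring]

/-- The interpolated exponent is integrable (`> 1`) iff `j ρ < (ρ − 1) S`. [folklore] -/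
theorem interp_gt_one_iff {ρ a S j : ℝ} (hS : 0 < S) :
    1 < interpExponent ρ a (a + S) (a + j) ↔ j * ρ < (ρ - 1) * S := by
  rw [interpExponent_span ρ a S j]
  rw [show ρ * (1 - j / S) = (ρ * S - ρ * j) / S by field_simp]
  rw [lt_div_iff₀ hS]
  constructor <;> intro h <;> nlinarith

/-- With the refereed supply exponent `ρ = 1 + 3δ/4`: integrable at level `a + j` iff `j (4 + 3δ) < 3 δ S`. [folklore] -/
theorem repair_iff {δ a S j : ℝ} (hS : 0 < S) :
    1 < interpExponent (rateJ δ) a (a + S) (a + j) ↔ j * (4 + 3 * δ) < 3 * δ * S := by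
  rw [interp_gt_one_iff hS, rateJ]
  constructor <;> intro h <;> nlinarith

/-- Even `k_large = 2m` (so `a = k_small − 1 = m`, missing levels `j ≤ 3`, and — MODULE'S READING — no-decay sup level
`k_large + 5 = 2m + 5`, span `S = m + 5`): the top missing level gets an integrable rate iff `4 − 2δ < δ m`, i.e.
`k_large > 8/δ − 4`.  (The no-decay level `k_large + 5` is the module's reading, see the header §5.) [folklore] -/
theorem repair_even_iff (δ : ℝ) (m : ℕ) :
    1 < interpExponent (rateJ δ) (m : ℝ) ((m : ℝ) + ((m : ℝ) + 5)) ((m : ℝ) + 3) ↔ 4 - 2 * δ < δ * m := by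
  have hS : (0 : ℝ) < (m : ℝ) + 5 := by positivity
  rw [repair_iff hS]
  constructor <;> intro h <;> nlinarith

/-- Odd `k_large = 2m + 1` (`a = m`, missing levels `j ≤ 4`, no-decay sup level `2m + 6`, span `S = m + 6`): integrable at the
top missing level iff `16 − 6δ < 3 δ m`, i.e. `k_large > 32/(3δ) − 3`.  (Same reading.) [folklore] -/
theorem repair_odd_iff (δ : ℝ) (m : ℕ) :
    1 < interpExponent (rateJ δ) (m : ℝ) ((m : ℝ) + ((m : ℝ) + 6)) ((m : ℝ) + 4) ↔ 16 - 6 * δ < 3 * δ * m := by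
  have hS : (0 : ℝ) < (m : ℝ) + 6 := by positivity
  rw [repair_iff hS]
  constructor <;> intro h <;> nlinarith

/-- Sanity instance of the price: at `δ_dec = 1/100` the even-parity threshold reads `m > 398`, i.e. `k_large ≥ 798`
suffices and `k_large = 796` does not (pure arithmetic; the papers fix no numerical `δ_dec`). -/
example : (4 : ℝ) - 2 * (1 / 100) < (1 / 100) * (399 : ℕ) ∧ ¬ ((4 : ℝ) - 2 * (1 / 100) < (1 / 100) * (398 : ℕ)) := by
  constructor <;> norm_num

end Literature.Geometry.Lorentzian.KlainermanSzeftel2021.JunctionLevels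

end
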